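import Summits.CriticalPhenomena.CardyFormulaZ2.Theorems.CardySelfDualSegmentUniformBoxCrossingStubLinkPart2
import HarnessLib

/-!
# Stub `stub_link` (crux stmt-CriticalPhenomena-5476 `UniformBoxCrossing`, line `Sketch`):
# the spliced, recoloured configuration has joined crossings

The registered stub `stub_link : LinkStatement` of the lead's skeleton
(`Cruxes/UniformBoxCrossing/Lines/Sketch.lean`): the deterministic heart of Bollobás–Riordan's
translation-only Russo–Seymour–Welsh argument (arXiv:1001.4674, §5.1, proof of Thm. 5.3,
p. 22–23), for the corner models `M_t`.

Data: coins `S₁` (configuration `ω₁`; explored sets `D₁ = dualBelow n ω₁` of `S₁ = [0,n]²` from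
below and `D₂ = dualAbove n s ω₁` of `S₂ = S₁ + (0,s)` from above; regions `A`, `B`), fresh coins
`S₂` with a non-slant path in `[0, m]²`, a translation `X` such that the link walk
`W = nsPath + X` runs from `A` to `B` inside the strip `[0, n] × ℤ`; the junction corners of the
minimal link of `W` are recoloured in `S₁` (both their edges opened; the explorations do not
change, hypotheses `hD1`, `hD2` supplied by `stub_junction`), and the final coins are
`S' = brSplice n s (S̃₁, S₂, X)`: those of `S̃₁` on the examined coins, those of `S₂ + X` elsewhere.

Proof (`stub_link`), following the print proof:
0. `S'` agrees with `S̃₁` on the examined coins, so (`ExaminedStatement`) it has the same explored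
   sets `D₁`, `D₂`, hence the same hull, regions and examined coins, and `H(S₁)`, `H(S₂)` hold for
   it ("no top face explored", `not_mem_dualBelow_of_lrCrossing`, `reflConfig_mem_lrCrossing_link`).
1. `P₁`, `P₂`: interface walks of the lower hull of `ω' = cornerConfig S'` and of its reflection
   (`exists_lowerInterfaceWalk`), open in `ω'` (`isOpen_of_interfaceWalk`).
2. The minimal link `q` of `W` from `A` to `B` (`isLink_minimalLink`) is nontrivial (`A ∩ B = ∅`
   by `hdisj`), starts on `P₁` and ends on `P₂` (the interface lemma `mem_support_of_exit` of
   part 1, at both ends, the `P₂` end in the reflected picture), and is open in `ω'`: a corner of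
   one of its edges is either unexamined — then its coins are those of `S₂ + X` and the edge is a
   translate of an edge of the open non-slant path — or examined, hence in `A ∪ B`
   (`mem_region_of_mem_examinedCoins`, part 2), hence an endpoint of `q`, hence a junction
   corner, where the imposed pattern opens both edges.
3. Assemble `a₁ → P₁ → q → P₂ → a₂ + (0, s)` inside `[0, n] × [0, n + s]`.

## References

* B. Bollobás, O. Riordan, *Percolation on self-dual polygon configurations*, Bolyai Soc. Math.
  Stud. 21 (2010) 131–217, arXiv:1001.4674, §5.1 proof of Thm. 5.3, §5.2. [BollobasRiordan2010]
-/

noncomputable section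

namespace Summit.CriticalPhenomena.CardyFormulaZ2.Cruxes.UniformBoxCrossing.NonSlantLine

open SimpleGraph Finset Literature.Probability.Percolation Literature.Probability.LatticeModels

/-- **The link** (Bollobás–Riordan 2010, proof of Thm. 5.3: "the minimal subpath `P'` of `P + X`
meeting `A` and `B` … is present in `ω` and joins `P₁` and `P₂`, and `ω ∈ J`"), for the corner
models: the spliced, recoloured configuration has joined horizontal crossings of the two stacked
squares. [cite: BollobasRiordan2010, §5.1 proof of Thm. 5.3] -/
theorem stub_link : LinkStatement := by
  intro hbridge hexam n s m S₁ S₂ X hs1 hsn hH1 hH2 hdisj hNS hWA hWB hstrip hD1 hD2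
  -- abbreviations
  set ω₁ := cornerConfig S₁ with hω₁
  set A := lowerRegion n ω₁ with hA
  set B := upperRegion n s ω₁ with hB
  set W := linkWalk m S₂ X with hW
  set S₁' := (recolour n s m (S₁, S₂, X)).1 with hS₁'
  set S' := brSplice n s (recolour n s m (S₁, S₂, X)) with hS'
  set ω' := cornerConfig S' with hω'
  have hn : 1 ≤ n := hs1.trans hsn
  have hω₁E : ω₁ ⊆ (zdGraph 2).edgeSet := cornerConfig_subset_edgeSet S₁
  have hω'E : ω' ⊆ (zdGraph 2).edgeSet := cornerConfig_subset_edgeSet S'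
  /- Step 0: the splice agrees with the recoloured coins on the examined coins, so it has the
  same explored sets, hull, regions and examined coins. -/
  have hagree : ∀ i ∈ examinedCoins n s S₁', i ∈ S₁' ↔ i ∈ S' :=
    fun i hi => (mem_brSplice_iff_of_mem hi).symm
  obtain ⟨hDB', hDA'⟩ := hexam n s S₁' S' hagree
  have hDB : dualBelow n ω' = dualBelow n ω₁ := hDB'.trans hD1
  have hDA : dualAbove n s ω' = dualAbove n s ω₁ := hDA'.trans hD2
  have hAeq : lowerRegion n ω' = A := lowerRegion_congr n hDB
  have hBeq : upperRegion n s ω' = B := upperRegion_congr n s hDA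
  have hEx : examinedCoins n s S₁' = examinedCoins n s S₁ := examinedCoins_eq_of_eq n s hD1 hD2
  -- `H(S₁)` and `H(S₂)` for `ω'`, as "no top face explored"
  have htop₁ : ∀ f ∈ dualTopSide n n, f ∉ dualBelow n ω' := fun f hf => by
    rw [hDB]
    exact not_mem_dualBelow_of_lrCrossing hω₁E hH1 hf
  have htop₂ : ∀ f ∈ dualTopSide n n, f ∉ dualBelow n (reflConfig n s ω') := fun f hf => by
    rw [dualBelow_reflConfig_eq_of_dualAbove_eq n s hDA]
    exact not_mem_dualBelow_of_lrCrossing (reflConfig_subset_edgeSet_link hω₁E)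
      (reflConfig_mem_lrCrossing_link hH2) hf
  /- Step 1: the two interface crossings `P₁` (of `S₁`, from below) and `P₂` (of `S₂`, from
  above: the reflection of the interface crossing `π₂` of the reflected configuration). -/
  obtain ⟨P₁, hP₁c, hP₁d⟩ := exists_lowerInterfaceWalk n htop₁
  obtain ⟨π₂, hπ₂c, hπ₂d⟩ := exists_lowerInterfaceWalk n htop₂
  have hP₁o : ∀ e ∈ P₁.walk.edges, e ∈ ω' := isOpen_of_interfaceWalk hP₁d
  have hπ₂o : ∀ e ∈ π₂.walk.edges, e ∈ reflConfig n s ω' := isOpen_of_interfaceWalk hπ₂d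
  have hP₁S : ∀ z ∈ P₁.walk.support, z ∈ (↑(rectangle n n) : Set (Site 2)) :=
    fun z hz => Finset.mem_coe.2 (hP₁c.subset z hz)
  have hP₂o : ∀ e ∈ (π₂.map (upperRefl n s)).walk.edges, e ∈ ω' := fun e he => by
    obtain ⟨e₀, he₀, rfl⟩ := XWalk.mem_edges_map_iff.1 he
    exact (mem_reflConfig_iff n s ω' e₀).1 (hπ₂o e₀ he₀)
  have hP₂S : ∀ z ∈ (π₂.map (upperRefl n s)).walk.support, z ∈ upperSquare n s := fun z hz => by
    obtain ⟨y, hy, rfl⟩ := XWalk.mem_support_map_iff.1 hz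
    exact upperRefl_mem_upperSquare (hπ₂c.subset y hy)
  /- Step 2: the minimal link `q` of `W` from `A` to `B`. -/
  have hq : IsLink A B W (minimalLink A B W) := isLink_minimalLink hWA hWB
  set q := minimalLink A B W with hqdef
  -- `A` and `B` do not meet, so `q` is nontrivial
  have hAB : ∀ c, c ∈ A → c ∈ B → False := fun c hcA hcB => by
    have h1 := le_apply_one_of_mem_upperRegion hcB
    obtain ⟨h2, h3, h4⟩ := bounds_of_mem_lowerRegion hcA (by omega)
    exact hdisj c (mem_rectangle_iff.2 ⟨h2, h3, by omega, by push_cast; omega⟩) hcA hcB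
  have hne : q.fst ≠ q.snd := fun h => hAB _ hq.fst_mem (by rw [h]; exact hq.snd_mem)
  have hqn : q.walk.darts ≠ [] := by
    rw [Ne, Walk.darts_eq_nil]
    exact Walk.not_nil_of_ne hne
  -- the first and the last dart of `q`
  obtain ⟨d₁, hd₁h⟩ : ∃ d, q.walk.darts.head? = some d := ⟨_, List.head?_eq_some_head hqn⟩
  obtain ⟨d₂, hd₂l⟩ : ∃ d, q.walk.darts.getLast? = some d := ⟨_, List.getLast?_eq_some_getLast hqn⟩
  have hd₁ : d₁ ∈ q.walk.darts := List.mem_of_mem_head? hd₁h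
  have hd₂ : d₂ ∈ q.walk.darts := List.mem_of_mem_getLast? hd₂l
  have hd₁f : d₁.fst = q.fst := fst_eq_of_darts_head? hd₁h
  have hd₂s : d₂.snd = q.snd := snd_eq_of_darts_getLast? hd₂l
  -- the vertices of `q` are vertices of `W`, in the strip
  have hqW : ∀ z ∈ q.walk.support, z ∈ W.walk.support := fun z hz => by
    rcases eq_start_or_exists_dart_snd_eq hz with rfl | ⟨d, hd, rfl⟩
    · rw [← hd₁f]
      exact W.walk.dart_fst_mem_support_of_mem_darts (hq.darts_sub d₁ hd₁)
    · exact W.walk.dart_snd_mem_support_of_mem_darts (hq.darts_sub d hd)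
  have hqcol : ∀ z ∈ q.walk.support, 0 ≤ z 0 ∧ z 0 ≤ n := fun z hz => hstrip z (hqW z hz)
  /- (2a) The link starts on `P₁` … -/
  have ha : q.fst ∈ P₁.walk.support := by
    have hcol := hstrip _ (W.walk.dart_snd_mem_support_of_mem_darts (hq.darts_sub d₁ hd₁))
    refine mem_support_of_exit hbridge hω'E hn htop₁ hP₁c hP₁d ?_ ?_
      (by rw [← hd₁f]; exact d₁.adj) hcol.1 hcol.2
    · rw [hAeq]; exact hq.fst_mem
    · rw [hAeq]; exact hq.snd_notMem d₁ hd₁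
  /- … and ends on `P₂` (the reflected picture). -/
  have hb : q.snd ∈ (π₂.map (upperRefl n s)).walk.support := by
    have hcol := hstrip _ (W.walk.dart_fst_mem_support_of_mem_darts (hq.darts_sub d₂ hd₂))
    have key : upperRefl n s q.snd ∈ π₂.walk.support := by
      refine mem_support_of_exit hbridge (reflConfig_subset_edgeSet_link hω'E) hn htop₂ hπ₂c hπ₂d
        (a := upperRefl n s q.snd) (u := upperRefl n s d₂.fst) ?_ ?_ ?_ ?_ ?_
      · exact (mem_upperRegion_iff n s).1 (by rw [hBeq]; exact hq.snd_mem)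
      · exact fun h => hq.fst_notMem d₂ hd₂ (by rw [← hBeq]; exact (mem_upperRegion_iff n s).2 h)
      · exact (upperRefl n s).map_adj_iff.2 (by rw [← hd₂s]; exact d₂.adj.symm)
      · rw [upperRefl_apply_zero]; exact hcol.1
      · rw [upperRefl_apply_zero]; exact hcol.2
    exact XWalk.mem_support_map_iff.2 ⟨_, key, upperRefl_upperRefl n s _⟩
  /- (2b) The link is open in `ω'`. -/
  have hqopen : ∀ e ∈ q.walk.edges, e ∈ ω' := by
    intro e he
    rw [Walk.edges] at he
    obtain ⟨d, hd, rfl⟩ := List.mem_map.1 he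
    have hdW : d ∈ W.walk.darts := hq.darts_sub d hd
    obtain ⟨⟨z, i⟩, hzi⟩ := mem_edgeSet_iff_exists_cornerEdge.1 d.edge_mem
    rw [← hzi]
    by_cases hex : (z, (0 : Fin 2)) ∈ examinedCoins n s S₁'
    · -- an examined corner on the link is one of its endpoints, hence a recoloured junction corner
      refine cornerEdge_mem_cornerConfig_brSplice_recolour (S₁, S₂, X) hex ?_ i
      show z ∈ endCorners q
      have hzAB : z ∈ A ∨ z ∈ B := mem_region_of_mem_examinedCoins (i := (z, 0)) (hEx ▸ hex)
      have hzd : z = d.fst ∨ z = d.snd := by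
        have hzmem : z ∈ d.edge := by rw [← hzi]; exact Sym2.mem_mk_left _ _
        exact Sym2.mem_iff.1 hzmem
      have hcz : cornerOf d.edge = z := by rw [← hzi, cornerOf_cornerEdge]
      rcases hzd with hz | hz
      · -- `z = d.fst ∉ B`, so `z ∈ A` and `d` is the first dart
        have hzA : z ∈ A := hzAB.resolve_right (hz ▸ hq.fst_notMem d hd)
        rcases darts_head?_eq_or_exists_snd_eq hd with hh | ⟨d', hd', hd'e⟩
        · exact hcz ▸ cornerOf_mem_endCorners_of_head? hh
        · exact absurd (by rw [hd'e, ← hz]; exact hzA : d'.snd ∈ A) (hq.snd_notMem d' hd')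
      · -- `z = d.snd ∉ A`, so `z ∈ B` and `d` is the last dart
        have hzB : z ∈ B := hzAB.resolve_left (hz ▸ hq.snd_notMem d hd)
        rcases darts_getLast?_eq_or_exists_fst_eq hd with hh | ⟨d', hd', hd'e⟩
        · exact hcz ▸ cornerOf_mem_endCorners_of_getLast? hh
        · exact absurd (by rw [hd'e, ← hz]; exact hzB : d'.fst ∈ B) (hq.fst_notMem d' hd')
    · -- an unexamined corner: its coins are those of `S₂ + X`
      have hex' : ∀ j, (z, j) ∉ examinedCoins n s S₁' :=
        fun j h => hex ((mem_examinedCoins_iff_fst j 0).1 h)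
      rw [cornerEdge_mem_cornerConfig_brSplice_iff_of_not_mem _ hex' i]
      show Literature.Probability.Percolation.cornerEdge (z - X, i) ∈ cornerConfig S₂
      obtain ⟨w₀, hw₀⟩ := exists_isNonSlantPath (cornerConfig_subset_edgeSet S₂) hNS
      refine (isNonSlantPath_nsPath hw₀).isOpen _ ?_
      have hmem : Literature.Probability.Percolation.cornerEdge (z, i) ∈ W.walk.edges := by
        rw [hzi, Walk.edges]
        exact List.mem_map.2 ⟨d, hdW, rfl⟩
      obtain ⟨e₀, he₀, he₀eq⟩ :=
        (XWalk.mem_edges_shift (w := nsPath m (cornerConfig S₂)) (X := X)).1 hmem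
      have he₀' : Literature.Probability.Percolation.cornerEdge (z - X, i) = e₀ :=
        Sym2.map.injective (add_left_injective X)
          (by rw [cornerEdge_map_add, sub_add_cancel]; exact he₀eq)
      rw [he₀']
      exact he₀
  /- (2c) The link lies in `S₁ ∪ S₂ = [0, n] × [0, n + s]`. -/
  have hv0 : (![0, (s : ℤ)] : Site 2) 0 = 0 := rfl
  have hv1 : (![0, (s : ℤ)] : Site 2) 1 = s := rfl
  have hqS : ∀ z ∈ q.walk.support, z ∈ (↑(rectangle n (n + s)) : Set (Site 2)) := by
    intro z hz
    rw [Finset.mem_coe, mem_rectangle_iff]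
    obtain ⟨hz0, hz0'⟩ := hqcol z hz
    refine ⟨hz0, hz0', ?_, ?_⟩
    · rcases eq_start_or_exists_dart_snd_eq hz with rfl | ⟨d, hd, rfl⟩
      · exact (mem_rectangle_iff.1 (hP₁c.subset _ ha)).2.2.1
      · by_contra hlt
        exact hq.snd_notMem d hd (Or.inl (by omega))
    · rcases eq_end_or_exists_dart_fst_eq hz with rfl | ⟨d, hd, rfl⟩
      · have h := hP₂S _ hb
        rw [upperSquare, mem_image_add_rectangle, hv0, hv1] at h
        push_cast
        omega
      · by_contra hlt
        push_cast at hlt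
        exact hq.fst_notMem d hd (mem_upperRegion_of_lt n s (by omega))
  /- Step 3: assemble the JOIN event. -/
  have e1 : reflY (n : ℤ) π₂.fst + ![0, (s : ℤ)] = upperRefl n s π₂.fst := reflY_add_eq_upperRefl _
  have e2 : reflY (n : ℤ) π₂.snd + ![0, (s : ℤ)] = upperRefl n s π₂.snd := reflY_add_eq_upperRefl _
  have hπ₂fst := mem_rectangle_iff.1 (hπ₂c.subset _ π₂.walk.start_mem_support)
  have hπ₂snd := mem_rectangle_iff.1 (hπ₂c.subset _ π₂.walk.end_mem_support)
  refine ⟨P₁.fst, ?_, P₁.snd, ?_, reflY (n : ℤ) π₂.fst, ?_, reflY (n : ℤ) π₂.snd, ?_, ?_, ?_, ?_⟩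
  · simp only [leftSide, Finset.mem_filter]
    exact ⟨hP₁c.subset _ P₁.walk.start_mem_support, hP₁c.start⟩
  · simp only [rightSide, Finset.mem_filter]
    exact ⟨hP₁c.subset _ P₁.walk.end_mem_support, hP₁c.finish⟩
  · simp only [leftSide, Finset.mem_filter, mem_rectangle_iff, reflY_apply_zero, reflY_apply_one]
    exact ⟨⟨hπ₂fst.1, hπ₂fst.2.1, by omega, by omega⟩, hπ₂c.start⟩
  · simp only [rightSide, Finset.mem_filter, mem_rectangle_iff, reflY_apply_zero, reflY_apply_one]
    exact ⟨⟨hπ₂snd.1, hπ₂snd.2.1, by omega, by omega⟩, hπ₂c.finish⟩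
  · -- the crossing of `S₁`
    exact mem_openConnIn_of_walk P₁.walk hP₁S hP₁o
  · -- the crossing of `S₂`
    rw [e1, e2]
    exact mem_openConnIn_of_walk (π₂.map (upperRefl n s)).walk hP₂S hP₂o
  · -- the junction `a₁ → P₁ → q → P₂ → a₂ + (0, s)` inside `[0, n] × [0, n + s]`
    have hR₁ : (↑(rectangle n n) : Set (Site 2)) ⊆ ↑(rectangle n (n + s)) := fun z hz => by
      rw [Finset.mem_coe, mem_rectangle_iff] at hz ⊢
      push_cast
      omega
    have hR₂ : upperSquare n s ⊆ (↑(rectangle n (n + s)) : Set (Site 2)) := fun z hz => by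
      rw [upperSquare, mem_image_add_rectangle, hv0, hv1] at hz
      rw [Finset.mem_coe, mem_rectangle_iff]
      push_cast
      omega
    have c₁ : ω' ∈ openConnIn ↑(rectangle n (n + s)) P₁.fst q.fst :=
      openConnIn_mono hR₁ _ _ (mem_openConnIn_of_mem_support P₁.walk hP₁S hP₁o ha)
    have c₂ : ω' ∈ openConnIn ↑(rectangle n (n + s)) q.fst q.snd :=
      mem_openConnIn_of_walk q.walk hqS hqopen
    have c₃ : ω' ∈ openConnIn ↑(rectangle n (n + s)) q.snd (upperRefl n s π₂.fst) := by
      rw [openConnIn_comm]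
      exact openConnIn_mono hR₂ _ _
        (mem_openConnIn_of_mem_support (π₂.map (upperRefl n s)).walk hP₂S hP₂o hb)
    rw [e1]
    exact PlanarDuality.openConnIn_trans (PlanarDuality.openConnIn_trans c₁ c₂) c₃

end Summit.CriticalPhenomena.CardyFormulaZ2.Cruxes.UniformBoxCrossing.NonSlantLine
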